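import Summits.ResolutionOfSingularities.ResolutionOfSingularities.Theorems.ValuativeLuAlphaPTorsorColengthDrop

/-!
# The strict transform on the exceptional line of the chart (Giraud 1983, §2.5, case (B))

Helper file for the stubs `exists_strictTransform_chart_length_le` (V5a) and
`strictTransform_not_mem_of_order_one` (V5b) of the line `pfaff-line-log-final-forms` (crux
`Valuative.LuAlphaPTorsor`, item `stmt-ResolutionOfSingularities-0641`).

Setting: `(R, 𝔪 = (x, y))` a two-dimensional regular local subring of the field `K`,
`A = R[y/x] ⊆ K` the chart of the blowing up of the closed point (`chartAdjoin`, structure map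
`ι = chartIncl x y`, `𝔪A = xA`), with reduction map `ρ : A → A/xA ≅ κ[X]`
(`exists_reduction_chartAdjoin`). For `φ ∈ 𝔪ˢ ∖ 𝔪ˢ⁺¹` the strict transform is
`ψ = F(y/x)` with `ι φ = xˢ ψ`, `F ∈ R[X]` of degree `≤ s` and `ρ ψ = F̄ ≠ 0`.

* `length_quotient_span_pair_mul_le` — `λ(T/(x, pb)) ≤ λ(T/(x, b)) + λ(T/(x, p))` in any
  commutative ring (`(x, b)/(x, pb)` is a cyclic module killed by `(x, p)`);
* `length_quotient_span_pair_le_natDegree` — **the exceptional-line bound, abstractly**: for a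
  surjection `ρ : A → k[X]` with kernel `xA`, a prime `Q ∋ x` of `A` and `T = A_Q`:
  `λ_T(T/(x, a)T) ≤ deg ρ(a)` whenever `ρ a ≠ 0` (induction on the degree: `Q = (x, p)` with
  `ρ p = P` the generator of `ρ(Q)`, and `ρ a ∈ (P)` gives `a ≡ p a₁ mod x` with
  `deg ρ a₁ < deg ρ a`);
* `exists_strictTransform_chart_length_le` — **V5a**: `λ_{A_Q}(A_Q/(x, ψ)) ≤ s` at every prime
  `Q ∋ x` of the chart;
* `strictTransform_not_mem_of_order_one` — **V5b** (`s = 1`, `φ ≡ αx + βy mod 𝔪²`,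
  `ψ ≡ α + β·(y/x) mod xA`): `ψ ∉ Q` if `α` is a unit and `y/x ∈ Q`, or if `α` or `β` is a
  unit and `Q` is a non-rational point of the exceptional line.

References: J. Giraud, *Forme normale d'une fonction sur une surface de caractéristique
positive*, Bull. SMF 111 (1983), §2.5; O. Zariski, P. Samuel, *Commutative Algebra* II (1960),
Appendix 5; C. Huneke, I. Swanson, *Integral Closure of Ideals, Rings, and Modules* (2006), §14.2.
-/

set_option linter.dupNamespace false

noncomputable section

open IsLocalRing Polynomial Literature.AlgebraicGeometry.Resolution

namespace Summit.ResolutionOfSingularities.ResolutionOfSingularities.Theorems.PfaffLine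

section Abstract

variable {T : Type*} [CommRing T]

/-- In a commutative ring: `λ(T/(x, pb)) ≤ λ(T/(x, b)) + λ(T/(x, p))` — the kernel
`(x, b)/(x, pb)` of `T/(x, pb) → T/(x, b)` is the cyclic module generated by the class of `b`,
and it is killed by `(x, p)`. [folklore] -/
theorem length_quotient_span_pair_mul_le (x p b : T) :
    Module.length T (T ⧸ Ideal.span {x, p * b}) ≤
      Module.length T (T ⧸ Ideal.span {x, b}) + Module.length T (T ⧸ Ideal.span {x, p}) := by
  have hxN : x ∈ Ideal.span {x, p * b} := Ideal.subset_span (Set.mem_insert _ _)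
  have hle : Ideal.span {x, p * b} ≤ Ideal.span {x, b} := by
    rw [Ideal.span_le]
    rintro t ht
    rcases ht with rfl | rfl
    · exact Ideal.subset_span (Set.mem_insert _ _)
    · exact Ideal.mul_mem_left _ p (Ideal.subset_span (Set.mem_insert_of_mem _ rfl))
  -- `λ(T/N) = λ(ker (T/N → T/N')) + λ(T/N')`
  have hexact := Module.length_eq_add_of_exact (LinearMap.ker (Submodule.factor hle)).subtype
    (Submodule.factor hle) (Submodule.injective_subtype _) (Submodule.factor_surjective hle)
    (LinearMap.exact_subtype_ker_map _)
  -- `g₀ : T → T/N`, `t ↦ [b t]`, kills `(x, p)`, and its range contains the kernel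
  let g₀ : T →ₗ[T] T ⧸ Ideal.span {x, p * b} :=
    (Submodule.mkQ (Ideal.span {x, p * b})).comp (LinearMap.mulLeft T b)
  have hg₀ : ∀ t, g₀ t = Submodule.Quotient.mk (b * t) := fun t => rfl
  have hkerg : Ideal.span {x, p} ≤ LinearMap.ker g₀ := by
    rw [Ideal.span_le]
    rintro t ht
    rw [SetLike.mem_coe, LinearMap.mem_ker, hg₀, Submodule.Quotient.mk_eq_zero]
    rcases ht with rfl | rfl
    · exact Ideal.mul_mem_left _ b hxN
    · rw [mul_comm]
      exact Ideal.subset_span (Set.mem_insert_of_mem _ rfl)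
  set g := Submodule.liftQ (Ideal.span {x, p}) g₀ hkerg with hg
  have hrange : LinearMap.ker (Submodule.factor hle) ≤ LinearMap.range g := by
    rw [hg, Submodule.range_liftQ]
    intro z hz
    obtain ⟨t, rfl⟩ := Submodule.mkQ_surjective _ z
    have hz' : (Submodule.Quotient.mk t : T ⧸ Ideal.span {x, b}) = 0 := hz
    rw [Submodule.Quotient.mk_eq_zero] at hz'
    obtain ⟨c, d, rfl⟩ := Ideal.mem_span_pair.mp hz'
    refine ⟨d, ?_⟩
    rw [hg₀, Submodule.mkQ_apply, eq_comm, Submodule.Quotient.eq]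
    have e : c * x + d * b - b * d = c * x := by ring
    rw [e]
    exact Ideal.mul_mem_left _ c hxN
  calc Module.length T (T ⧸ Ideal.span {x, p * b})
      = Module.length T (LinearMap.ker (Submodule.factor hle)) +
          Module.length T (T ⧸ Ideal.span {x, b}) := hexact
    _ ≤ Module.length T (T ⧸ Ideal.span {x, p}) + Module.length T (T ⧸ Ideal.span {x, b}) := by
        refine add_le_add ?_ le_rfl
        calc Module.length T (LinearMap.ker (Submodule.factor hle))
            ≤ Module.length T (LinearMap.range g) :=
              Module.length_le_of_injective (Submodule.inclusion hrange)
                (Submodule.inclusion_injective hrange)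
          _ ≤ Module.length T (T ⧸ Ideal.span {x, p}) :=
              Module.length_le_of_surjective g.rangeRestrict g.surjective_rangeRestrict
    _ = _ := add_comm _ _

/-- **The exceptional-line bound, abstract form.** Let `ρ : A → k[X]` be a surjective ring
homomorphism onto the polynomial ring over a field with kernel inside `xA` (and `ρ x = 0`), `Q` a
prime of `A` containing `x`, and `T = A_Q`. Then for every `a ∈ A` with `ρ a ≠ 0`:
`λ_T(T/(x, a)T) ≤ deg ρ(a)`. Proof: `ρ(Q) = (P)` in the principal ideal domain `k[X]` and
`Q = (x, p)` for a lift `p` of `P`, so `T/(x, p)T` is the residue field; if `ρ a ∉ (P)` then `a`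
is a unit of `T`; otherwise `ρ a = P · ρ a₁`, `a ≡ p a₁ mod xA`, `deg ρ a₁ < deg ρ a`, and
`λ(T/(x, p a₁)) ≤ λ(T/(x, a₁)) + 1` (`length_quotient_span_pair_mul_le`). [folklore] -/
theorem length_quotient_span_pair_le_natDegree {A : Type*} [CommRing A] {k : Type*} [Field k]
    [Algebra A T] {ρ : A →+* k[X]} (hρs : Function.Surjective ρ) {x : A}
    (hker : ∀ a, ρ a = 0 → a ∈ Ideal.span {x}) (hρx : ρ x = 0) (Q : Ideal A) [Q.IsPrime]
    (hxQ : x ∈ Q) [IsLocalization.AtPrime T Q] (n : ℕ) (a : A) (ha0 : ρ a ≠ 0)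
    (han : (ρ a).natDegree ≤ n) :
    Module.length T (T ⧸ Ideal.span {algebraMap A T x, algebraMap A T a}) ≤ n := by
  haveI : IsLocalRing T := IsLocalization.AtPrime.isLocalRing T Q
  -- `ρ a ∈ ρ(Q) ⇒ a ∈ Q` (`ker ρ ⊆ xA ⊆ Q`)
  have hmem : ∀ a, ρ a ∈ Q.map ρ → a ∈ Q := fun a ha => by
    have h1 : a ∈ (Q.map ρ).comap ρ := Ideal.mem_comap.mpr ha
    rw [Ideal.comap_map_of_surjective ρ hρs] at h1
    obtain ⟨q, hq, z, hz, hqz⟩ := Submodule.mem_sup.mp h1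
    rw [← hqz]
    refine add_mem hq ((Ideal.span_singleton_le_iff_mem Q).mpr hxQ (hker z ?_))
    rwa [Ideal.mem_comap, Ideal.mem_bot] at hz
  -- `ρ(Q) = (P)`, `P = ρ p` not a unit, `Q = (x, p)`
  set P : k[X] := Submodule.IsPrincipal.generator (Q.map ρ) with hPdef
  have hQP : Q.map ρ = Ideal.span {P} := (Ideal.span_singleton_generator _).symm
  obtain ⟨p, hp⟩ := hρs P
  have hPunit : ¬ IsUnit P := by
    intro hu
    have htop : Q.map ρ = ⊤ := by rw [hQP]; exact Ideal.span_singleton_eq_top.mpr hu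
    exact Ideal.IsPrime.ne_top' ((Ideal.eq_top_iff_one Q).mpr (hmem 1 (by rw [htop]; trivial)))
  have hQeq : Q = Ideal.span {x, p} := by
    refine le_antisymm (fun q hq => ?_) ?_
    · have h1 : ρ q ∈ Ideal.span {P} := hQP ▸ Ideal.mem_map_of_mem ρ hq
      obtain ⟨c, hc⟩ := Ideal.mem_span_singleton'.mp h1
      obtain ⟨a', rfl⟩ := hρs c
      have h2 : ρ (q - a' * p) = 0 := by rw [map_sub, map_mul, hp, hc, sub_self]
      obtain ⟨d, hd⟩ := Ideal.mem_span_singleton'.mp (hker _ h2)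
      exact Ideal.mem_span_pair.mpr ⟨d, a', by rw [hd]; ring⟩
    · rw [Ideal.span_le]
      rintro t ht
      rcases ht with rfl | rfl
      · exact hxQ
      · exact hmem _ (by rw [hp, hQP]; exact Ideal.mem_span_singleton_self P)
  -- `T/(x, p)T = T/𝔪_T` has length `1`
  have hone : Module.length T (T ⧸ Ideal.span {algebraMap A T x, algebraMap A T p}) ≤ 1 := by
    have hmap : Ideal.span {algebraMap A T x, algebraMap A T p} = Q.map (algebraMap A T) := by
      rw [hQeq, Ideal.map_span, Set.image_pair]
    haveI : IsSimpleModule T (T ⧸ Ideal.span {algebraMap A T x, algebraMap A T p}) := by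
      rw [isSimpleModule_iff_isCoatom, hmap, ← Ideal.isMaximal_def]
      exact IsLocalization.AtPrime.isMaximal_map Q T
    rw [Module.length_eq_one]
  -- division by `P`: `ρ a ∈ (P)` gives `a = p a₁ + c x` with `deg ρ a₁ + 1 ≤ deg ρ a`
  have hstep : ∀ a, ρ a ≠ 0 → ρ a ∈ Q.map ρ → ∃ a₁ c : A, a = p * a₁ + c * x ∧ ρ a₁ ≠ 0 ∧
      (ρ a₁).natDegree + 1 ≤ (ρ a).natDegree := by
    intro a ha0 haQ
    rw [hQP, Ideal.mem_span_singleton] at haQ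
    obtain ⟨G, hG⟩ := haQ
    obtain ⟨a₁, rfl⟩ := hρs G
    have hP0 : P ≠ 0 := fun h => ha0 (by rw [hG, h, zero_mul])
    have ha₁ : ρ a₁ ≠ 0 := fun h => ha0 (by rw [hG, h, mul_zero])
    have h2 : ρ (a - p * a₁) = 0 := by rw [map_sub, map_mul, hp, hG, sub_self]
    obtain ⟨c, hc⟩ := Ideal.mem_span_singleton'.mp (hker _ h2)
    refine ⟨a₁, c, by rw [hc]; ring, ha₁, ?_⟩
    rw [hG, natDegree_mul hP0 ha₁]
    have : 0 < P.natDegree :=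
      natDegree_pos_iff_degree_pos.mpr (degree_pos_of_ne_zero_of_nonunit hP0 hPunit)
    omega
  -- units: `ρ a ∉ ρ(Q)` gives `(x, a)T = T`
  have hunit : ∀ a, ρ a ∉ Q.map ρ →
      Module.length T (T ⧸ Ideal.span {algebraMap A T x, algebraMap A T a}) = 0 := by
    intro a haQ
    have haQ' : a ∉ Q := fun h => haQ (Ideal.mem_map_of_mem ρ h)
    have htop : Ideal.span {algebraMap A T x, algebraMap A T a} = ⊤ :=
      Ideal.eq_top_of_isUnit_mem _ (Ideal.subset_span (Set.mem_insert_of_mem _ rfl))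
        (IsLocalization.map_units T (⟨a, haQ'⟩ : Q.primeCompl))
    exact Module.length_eq_zero_iff.mpr (Ideal.Quotient.subsingleton_iff.mpr htop)
  -- induction on the degree
  induction n generalizing a with
  | zero =>
    by_cases haQ : ρ a ∈ Q.map ρ
    · obtain ⟨a₁, c, -, -, hdeg⟩ := hstep a ha0 haQ
      omega
    · rw [hunit a haQ]
      exact zero_le
  | succ m ih =>
    by_cases haQ : ρ a ∈ Q.map ρ
    · obtain ⟨a₁, c, hac, ha₁, hdeg⟩ := hstep a ha0 haQ
      subst hac
      rw [map_add, map_mul, map_mul, Ideal.span_pair_add_mul_left]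
      calc Module.length T (T ⧸ Ideal.span {algebraMap A T x, algebraMap A T p * algebraMap A T a₁})
          ≤ Module.length T (T ⧸ Ideal.span {algebraMap A T x, algebraMap A T a₁}) +
              Module.length T (T ⧸ Ideal.span {algebraMap A T x, algebraMap A T p}) :=
            length_quotient_span_pair_mul_le _ _ _
        _ ≤ (m : ℕ∞) + 1 := add_le_add (ih a₁ ha₁ (by omega)) hone
        _ = ((m + 1 : ℕ) : ℕ∞) := by push_cast; rfl
    · rw [hunit a haQ]
      exact zero_le

end Abstract

section Chart

variable {K : Type*} [Field K] {R : Subring K} [IsRegularLocalRing R] {x y : R}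

/-- For a regular system of parameters `𝔪 = (x, y)` of a two-dimensional regular local ring:
`x ∣ yt ⇒ x ∣ t` (`x` is prime and does not divide `y`). [folklore] -/
theorem dvd_of_dvd_snd_mul (hdim : ringKrullDim R = 2) (hm : maximalIdeal R = Ideal.span {x, y})
    (t : R) (ht : x ∣ y * t) : x ∣ t := by
  have hxm : x ∈ maximalIdeal R := hm ▸ Ideal.subset_span (by simp)
  have hxp : Prime x := IsRegularLocalRing.prime_of_not_mem_sq hxm (fst_not_mem_sq hdim hm)
  refine (hxp.dvd_or_dvd ht).resolve_left fun hdvd => maximalIdeal_ne_span_singleton hdim x ?_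
  rw [hm]
  refine le_antisymm ?_ (Ideal.span_mono (Set.singleton_subset_iff.mpr (Set.mem_insert _ _)))
  rw [Ideal.span_le]
  rintro _ (rfl | rfl)
  · exact Ideal.mem_span_singleton_self _
  · exact Ideal.mem_span_singleton.mpr hdvd

/-- The reduction map `ρ : R[y/x] → κ[X]` kills `ι x`. [folklore] -/
theorem reduction_chartIncl_fst_eq_zero (hm : maximalIdeal R = Ideal.span {x, y})
    {ρ : chartAdjoin (K := K) x y →+* (ResidueField R)[X]}
    (hρ : ∀ G : R[X], ρ ⟨aeval (((y : R) : K) / ((x : R) : K)) G,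
      Polynomial.aeval_mem_adjoin_singleton R _⟩ = map (residue R) G) :
    ρ (chartIncl x y x) = 0 := by
  have hxm : x ∈ maximalIdeal R := hm ▸ Ideal.subset_span (by simp)
  have e : chartIncl (K := K) x y x = ⟨aeval (((y : R) : K) / ((x : R) : K)) (C x),
      Polynomial.aeval_mem_adjoin_singleton R _⟩ := Subtype.ext (by
    change ((x : R) : K) = aeval (((y : R) : K) / ((x : R) : K)) (C x)
    rw [aeval_C]
    rfl)
  rw [e, hρ (C x), Polynomial.map_C, (residue_eq_zero_iff x).mpr hxm, C_0]

end Chart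

open IsLocalRing

/-- **V5a — the strict transform meets the exceptional line in colength `≤ s`** (Giraud 1983,
§2.5 (B); Zariski–Samuel II, App. 5). For a two-dimensional regular local ring `(R, 𝔪 = (x, y))`
of `K` and `φ ∈ 𝔪ˢ ∖ 𝔪ˢ⁺¹` there is `ψ` in the chart `A = R[y/x]` with `ι φ = xˢ ψ` such that at
every prime `Q ∋ x` of `A`: `λ_{A_Q}(A_Q/(x, ψ)A_Q) ≤ s`. Indeed `ψ = F(y/x)` with `deg F ≤ s`
reduces modulo `xA` to `F̄ ≠ 0` in `κ[X]` (`𝔪ˢ⁺¹` is contracted from `A`), and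
`λ(A_Q/(x, ψ)) ≤ deg F̄` (`length_quotient_span_pair_le_natDegree`). [folklore] -/
theorem exists_strictTransform_chart_length_le : ∀ {K : Type} [Field K] {R : Subring K} [IsRegularLocalRing R] {x y : R}, ringKrullDim R = 2 → maximalIdeal R = Ideal.span {x, y} → x ≠ 0 → ∀ (φ : R) (s : ℕ), φ ∈ maximalIdeal R ^ s → φ ∉ maximalIdeal R ^ (s + 1) → ∃ ψ : Literature.AlgebraicGeometry.Resolution.chartAdjoin (K := K) x y, Literature.AlgebraicGeometry.Resolution.chartIncl x y φ = Literature.AlgebraicGeometry.Resolution.chartIncl x y x ^ s * ψ ∧ ∀ (Q : Ideal (Literature.AlgebraicGeometry.Resolution.chartAdjoin (K := K) x y)) [Q.IsPrime], Literature.AlgebraicGeometry.Resolution.chartIncl x y x ∈ Q → Module.length (LocalSubring.ofPrime (Literature.AlgebraicGeometry.Resolution.chartAdjoin (K := K) x y) Q).toSubring ((LocalSubring.ofPrime (Literature.AlgebraicGeometry.Resolution.chartAdjoin (K := K) x y) Q).toSubring ⧸ Ideal.span {algebraMap (Literature.AlgebraicGeometry.Resolution.chartAdjoin (K := K) x y)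 (LocalSubring.ofPrime (Literature.AlgebraicGeometry.Resolution.chartAdjoin (K := K) x y) Q).toSubring (Literature.AlgebraicGeometry.Resolution.chartIncl x y x), algebraMap (Literature.AlgebraicGeometry.Resolution.chartAdjoin (K := K) x y) (LocalSubring.ofPrime (Literature.AlgebraicGeometry.Resolution.chartAdjoin (K := K) x y) Q).toSubring ψ}) ≤ (s : ℕ∞) := by
  intro K _ R _ x y hdim hm hx0 φ s hφs hφs1
  letI : Algebra R (chartAdjoin (K := K) x y) := (chartIncl x y).toAlgebra
  have halg : algebraMap R (chartAdjoin (K := K) x y) = chartIncl x y := rfl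
  have hxm : x ∈ maximalIdeal R := hm ▸ Ideal.subset_span (by simp)
  have hx2 := fst_not_mem_sq hdim hm
  have hx0K : ((x : R) : K) ≠ 0 := fun e => hx0 (Subtype.ext e)
  have hinj : Function.Injective (algebraMap R (chartAdjoin (K := K) x y)) :=
    chartIncl_injective x y
  have hmS : (maximalIdeal R).map (algebraMap R (chartAdjoin (K := K) x y)) =
      Ideal.span {algebraMap R _ x} := map_maximalIdeal_chartIncl hm hx0
  have hS2 := exists_pow_mul_eq_chartIncl (K := K) hm hx0
  -- the reduction map and the strict transform `ψ = F(y/x)`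
  obtain ⟨ρ, hρs, hρ, hker⟩ :=
    exists_reduction_chartAdjoin (K := K) hm hx0 (dvd_of_dvd_snd_mul hdim hm)
  obtain ⟨F, hFdeg, hφF⟩ := exists_eq_pow_mul_aeval_colengthDrop hm hx0K s φ hφs
  set ψ : chartAdjoin (K := K) x y :=
    ⟨aeval (((y : R) : K) / ((x : R) : K)) F, Polynomial.aeval_mem_adjoin_singleton R _⟩ with hψdef
  have hψ : chartIncl x y φ = chartIncl x y x ^ s * ψ := Subtype.ext hφF
  have hψ0 : ρ ψ ≠ 0 := by
    intro h0
    obtain ⟨c, hc⟩ := Ideal.mem_span_singleton'.mp (hker ψ h0)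
    apply hφs1
    rw [← comap_map_pow_maximalIdeal hxm hx2 hinj hmS hS2 (s + 1), Ideal.mem_comap,
      map_pow_maximalIdeal_eq_span hmS, Ideal.mem_span_singleton', halg, hψ, ← hc]
    exact ⟨c, by ring⟩
  have hψdeg : (ρ ψ).natDegree ≤ s := by
    rw [hψdef, hρ F]
    exact natDegree_map_le.trans hFdeg
  refine ⟨ψ, hψ, fun Q _ hxQ => ?_⟩
  exact length_quotient_span_pair_le_natDegree hρs hker (reduction_chartIncl_fst_eq_zero hm hρ)
    Q hxQ s ψ hψ0 hψdeg

/-- **V5b — order one: the strict transform is a unit away from its direction** (Giraud 1983,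
§2.5 (B)). For `(R, 𝔪 = (x, y))` two-dimensional regular local in `K` and
`φ ≡ αx + βy mod 𝔪²`: `ι φ = x ψ` in `A = R[y/x]` with `ψ = ι α + ι β · (y/x) + x ψ₂`
(`𝔪²A = x²A`), and for a prime `Q ∋ x` of `A`, `ψ ∉ Q` as soon as either `α` is a unit and
`y/x ∈ Q`, or `α` or `β` is a unit and `y/x - ι γ ∉ Q` for all `γ ∈ R` (if `β` is a unit,
`ψ ∈ Q` would put `y/x + ι(β⁻¹α)` in `Q`; if not, `ι β ∈ xA ⊆ Q` and `ι α ∈ Q`). [folklore] -/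
theorem strictTransform_not_mem_of_order_one : ∀ {K : Type} [Field K] {R : Subring K} [IsRegularLocalRing R] {x y : R}, ringKrullDim R = 2 → maximalIdeal R = Ideal.span {x, y} → x ≠ 0 → ∀ (φ α β : R), φ - (α * x + β * y) ∈ maximalIdeal R ^ 2 → ∃ ψ : Literature.AlgebraicGeometry.Resolution.chartAdjoin (K := K) x y, Literature.AlgebraicGeometry.Resolution.chartIncl x y φ = Literature.AlgebraicGeometry.Resolution.chartIncl x y x * ψ ∧ ∀ (Q : Ideal (Literature.AlgebraicGeometry.Resolution.chartAdjoin (K := K) x y)) [Q.IsPrime], Literature.AlgebraicGeometry.Resolution.chartIncl x y x ∈ Q → ((IsUnit α ∧ (⟨((y : R) : K) / ((x : R) : K), Algebra.subset_adjoin (Set.mem_singleton _)⟩ : Literature.AlgebraicGeometry.Resolution.chartAdjoin (K := K) x y) ∈ Q) ∨ ((IsUnit α ∨ IsUnit β) ∧ ∀ γ : R, (⟨((y : R) : K) / ((x : R) : K), Algebra.subset_adjoin (Set.mem_singleton _)⟩ : Literature.AlgebraicGeometry.Resolution.chartAdjoin (K := K) x y) - Literature.AlgebraicGeometry.Resolution.chartIncl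 x y γ ∉ Q)) → ψ ∉ Q := by
  intro K _ R _ x y _ hm hx0 φ α β hφ
  have hx0K : ((x : R) : K) ≠ 0 := fun e => hx0 (Subtype.ext e)
  have hmS : (maximalIdeal R).map (chartIncl (K := K) x y) = Ideal.span {chartIncl x y x} :=
    map_maximalIdeal_chartIncl hm hx0
  -- `ι(φ - αx - βy) ∈ 𝔪²A = x²A`
  have h2 : chartIncl (K := K) x y (φ - (α * x + β * y)) ∈ Ideal.span {chartIncl x y x ^ 2} := by
    rw [← Ideal.span_singleton_pow, ← hmS, ← Ideal.map_pow]
    exact Ideal.mem_map_of_mem _ hφ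
  obtain ⟨ψ₂, hψ₂⟩ := Ideal.mem_span_singleton'.mp h2
  set t : chartAdjoin (K := K) x y :=
    ⟨((y : R) : K) / ((x : R) : K), Algebra.subset_adjoin (Set.mem_singleton _)⟩ with htdef
  have ht : chartIncl (K := K) x y y = chartIncl x y x * t := Subtype.ext (by
    change ((y : R) : K) = ((x : R) : K) * (((y : R) : K) / ((x : R) : K))
    field_simp)
  refine ⟨chartIncl x y α + chartIncl x y β * t + chartIncl x y x * ψ₂, ?_, ?_⟩
  · have e : chartIncl (K := K) x y φ =
        chartIncl x y (φ - (α * x + β * y)) + (chartIncl x y α * chartIncl x y x +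
          chartIncl x y β * chartIncl x y y) := by
      simp only [map_sub, map_add, map_mul]; ring
    rw [e, ← hψ₂, ht]
    ring
  · intro Q _ hxQ hcases hψQ
    have hαβ : chartIncl x y α + chartIncl x y β * t ∈ Q := by
      have := Q.sub_mem hψQ (Q.mul_mem_right ψ₂ hxQ)
      rwa [add_sub_cancel_right] at this
    have hunit : ∀ γ : R, IsUnit γ → chartIncl (K := K) x y γ ∉ Q := fun γ hγ h =>
      Ideal.IsPrime.ne_top' (Q.eq_top_of_isUnit_mem h (hγ.map _))
    have hnonunit : ∀ γ : R, ¬ IsUnit γ → chartIncl (K := K) x y γ ∈ Q := fun γ hγ => by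
      have h1 : chartIncl (K := K) x y γ ∈ (maximalIdeal R).map (chartIncl (K := K) x y) :=
        Ideal.mem_map_of_mem _ ((mem_maximalIdeal γ).mpr hγ)
      rw [hmS] at h1
      exact (Ideal.span_singleton_le_iff_mem Q).mpr hxQ h1
    rcases hcases with ⟨hα, htQ⟩ | ⟨hαβu, hnr⟩
    · refine hunit α hα ?_
      have := Q.sub_mem hαβ (Q.mul_mem_left (chartIncl x y β) htQ)
      rwa [add_sub_cancel_right] at this
    · by_cases hβ : IsUnit β
      · obtain ⟨βi, hβi⟩ := hβ.exists_left_inv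
        refine hnr (-(βi * α)) ?_
        have hβi' : chartIncl (K := K) x y βi * chartIncl x y β = 1 := by
          rw [← map_mul, hβi, map_one]
        have e : t - chartIncl x y (-(βi * α)) =
            chartIncl x y βi * (chartIncl x y α + chartIncl x y β * t) := by
          rw [map_neg, map_mul]
          linear_combination (-t) * hβi'
        rw [e]
        exact Q.mul_mem_left _ hαβ
      · refine hunit α (hαβu.resolve_right hβ) ?_
        have := Q.sub_mem hαβ (Q.mul_mem_right t (hnonunit β hβ))
        rwa [add_sub_cancel_right] at this

end Summit.ResolutionOfSingularities.ResolutionOfSingularities.Theorems.PfaffLine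

end
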